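import Summits.QuantumFields.YangMills.Theorems.BalabanUVNodesN23AtRecord
import Literature.MathematicalPhysics.QuantumFieldTheory.Balaban1983to89.Node00.Record9

/-!
# BalabanUVNodes ∕ N23 — and its cluster K1 «KnitIR» — AT NODE 00's STAGE-9 RECORD `Node00.IsRecordOfRecord₉C` (def-T's `Node00/Record9.lean`):
# the ₉C instances of N23's closers of record; binder B1's FREE side facts and the Track-A apex with B1 (through the END headline, B1 AND B2) eliminated,
# at ₉C records and at THE datum of record `Node00.datumOfRecord₉ θ h`; cluster K1 at ₉C BY NAME — there K1 ⟺ «inhabitation» ∧ «β₉ never overshoots»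
# (Track A, DAG node N23 = binder B1, [Balaban1987RG1] (0.3)–(0.4) p. 253; seat `pub-ymgap-dag-n23-a` g5; count-neutral)

HONEST FRAMING.  Count-neutral kernel BOOKKEEPING over landed modules, BY NAME; THEOREMS ONLY (0 `def`, 0 `sorry`, standard axioms); no estimate; nothing of
Bałaban's asserted.  N23 is DISCHARGED OF RECORD (pub-ymgap chair R439) — untouched.  NO inhabitation claim over `IsRecordOfRecord₉C` (plan K0 `Record9Inhabited`,
NODE 00∕W00's located-analytic item) is made: where inhabitation matters it is a DISPLAYED conjunct (∀-forms over ₉C pre-inhabitation are NOT discharges).  One finite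
four-torus programme at fixed `ε`; nothing continuum ∕ ℝ⁴ ∕ OS ∕ mass-gap ∕ Clay.  Filed `--supports` item `StabilityBAtRecord` (stmt-QuantumFields-19183); pattern of
`BalabanUVNodesN09AtRecord9`.  β-VERSION (RIDER №6 ∕ LINE №44): β here = `betaOfRecord₉` (= Stage 8's, read through the RN∕condKernel representative); no β-side
binder is booked at ₉; §4's no-overshoot face reads its point values as a CENSUS of what K1's unguarded (0.20) asks, not as a claim.  FORMAT FACE (RIDER №38):
no theorem here reads the `Sect2Form` ∕ `SLaw₉` ∕ `TLaw₉` slots of the ₉ record (B1 reads `D.av`; the apex forms take (B) ∕ the nodes as hypotheses).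

WHY A ₉C FILE.  `BalabanUVNodesN23AtRecord` (dag-n23-b) closes `S_N23` refinement-generically over ₀∕₅∕₅C∕₇C∕₈C∕₈X∕₈R and by the tower∕shadow shapes; its §3
docstring anticipated the ₉C instance via `IsRecordOfRecord₉C → ₅C` — which does NOT hold at the datum (located, `Record9` §7); the ₉C instance is the Stage-0
refinement `Node00.isDatumOfRecord₀_of_isRecordOfRecord₉C` (equivalently the tower-data closer, or the ₅C-SHADOW closer) — §1, three agreeing routes.
* §2 the FREE side facts (ROSTER-D0062 row n23 -b) at every ₉C record and at `datumOfRecord₉ θ h` (`N23Dossier` BY NAME).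
* §3 the apex at ₉C: B1 eliminated (`continuumYM4Torus_of_isRecordOfRecord₉C`, `_betaPertHyp`); B1 AND B2 eliminated through def-T's blanket-`Nodes` END transfer
  `Node00.endStatementBPrinted_of_isRecordOfRecord₉C_of_nodes` BY NAME (`…_of_nodes`, `_nonvacuous`, `continuumYM4TorusLaw_…`; the PINNED-children form is dag-n24-a's
  `Node00/N24GlueStage9C`, a different theorem) — the ₉C twins of `Node00/N23Record5C` §2.
* §4 K1 at ₉C: `s_N01∕s_N02_record₉C` (def-T's transferred instances), `knitIR₉C_iff_S_W00`, `s_W00_record₉C_iff`, `knitIR₉C_iff`; the UNGUARDED (0.20) leaf unfolded by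
  the tower-form assembler's `RGMachineCore.satisfiesRG_construction_iff` (`rgFlow_iff_noOvershoot_record₉`, `atRecord₉C_rgFlow_iff_noOvershoot`) ⇒
  `knitIR₉C_iff_inhabited_and_noOvershoot`; `inhabited₉C_iff` (K0's literal reading).  The GUARDED leaf is def-T's `Node00.rgFlow_of_smallCouplings_of_isRecordOfRecord₉C` (cited, not restated).
Sources: T. Bałaban, CMP **109** (1987) 249–301 [Balaban1987RG1] (0.3)–(0.4) p. 253, (0.18)–(0.20) pp. 255–256, Thm 2 p. 259; [Balaban1989LargeFieldII] Thm 1 p. 355;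
[JaffeWittenClay2006] §6.5 and [King1986] Thm 3.4 p. 656 (the apex targets' vocabulary, via `N23Dossier`).
-/

noncomputable section

namespace Summit.QuantumFields.YangMills.BalabanUVNodes.N23AtRecord9

open Literature.MathematicalPhysics.QuantumFieldTheory.Balaban1983to89
open Literature.MathematicalPhysics.QuantumFieldTheory.Balaban1983to89.Node00
open Literature.MathematicalPhysics.QuantumFieldTheory.Balaban1983to89.T4Continuum
  (T4Family FiniteEpsData LimitPointsRP LimitPointsCovariant BetaPertHyp)
open Literature.MathematicalPhysics.QuantumFieldTheory.Balaban1983to89.T4ContinuumYM4Torus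
  (ContinuumYM4Torus ContinuumYM4TorusE ContinuumYM4TorusLaw ForSmallCouplings)
open Literature.MathematicalPhysics.QuantumFieldTheory.Balaban1983to89.Missing (HasContinuumLimit)
open Literature.MathematicalPhysics.QuantumFieldTheory.Balaban1983to89.DagBinding (WorldP leavesP Nodes BetaBoundsInInterval EndpointExistence)
open Literature.MathematicalPhysics.QuantumFieldTheory.Balaban1983to89.FlowStep (prefixOf)
open Literature.MathematicalPhysics.QuantumFieldTheory.Balaban1983to89.FlowStepRuns (genSeq)
open YMDAG.UVSplit (RecordPred Datum AtRecord S_W00 S_N01 S_N02 S_N23 KnitIR)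
open Summit.QuantumFields.YangMills.BalabanUVNodes.N23AtRecord
  (s_N23_of_refines₀ s_N23_of_towerData s_N23_of_shadow₅C b1_of_s_N23 avgMeasurable_of_s_N23 rp_and_covariant_of_s_N23)
open Summit.QuantumFields.YangMills.BalabanUVNodes.N01AtRecord (knitIR_iff_stubs knitIR_iff_of_s_N01)

variable {N : ℕ} [NeZero N]

/-! ## §1 N23's closer of record AT THE STAGE-9 RECORD -/

/-- **`S_N23 Rec` FOR EVERY RECORD PREDICATE REFINING THE STAGE-9 RECORD** — one application of def-T's Stage-0 refinement
`Node00.isDatumOfRecord₀_of_isRecordOfRecord₉C` (the ₉ datum is `T4DatumAssembly.datumOfTower …`, whose `av` IS `avOfRecord`, `rfl`).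
[cite: Balaban1987RG1, (0.3)–(0.4) p.253; Balaban1989LargeFieldII, Thm 1 p.355 (kernel version at the objects of record, Stage 9)] -/
theorem s_N23_of_refines₉C (Rec : RecordPred N)
    (hRec : ∀ (F : T4Family) (D : Datum F N) (w : WorldP), Rec F D w → IsRecordOfRecord₉C F N D w) : S_N23 Rec :=
  s_N23_of_refines₀ Rec fun F D w hw => isDatumOfRecord₀_of_isRecordOfRecord₉C (hRec F D w hw)

/-- **N23 AT NODE 00's STAGE-9 RECORD `IsRecordOfRecord₉C` ITSELF** (the record of record of the rev-1 restate, plan R447∕R449).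
[cite: Balaban1987RG1, (0.3)–(0.4) p.253 (kernel version at the objects of record, Stage 9)] -/
theorem s_N23_record₉C : S_N23 (N := N) fun F D w => IsRecordOfRecord₉C F N D w :=
  s_N23_of_refines₉C _ fun _ _ _ h => h

/-- The same instance by the TOWER-DATA route (`s_N23_of_towerData`: the ₉ datum IS `datumOfTower F N (coreOfRecord₉ θ) (towerOfRecord₉ θ h)`).
[cite: Balaban1987RG1, (0.3)–(0.4) p.253 (bookkeeping: the routes agree)] -/
theorem s_N23_record₉C_towerData : S_N23 (N := N) fun F D w => IsRecordOfRecord₉C F N D w :=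
  s_N23_of_towerData _ fun F _ _ h => by
    obtain ⟨θ, hP, -, rfl, -⟩ := h
    exact ⟨coreOfRecord₉ F N θ, towerOfRecord₉ F N θ hP, rfl⟩

/-- The same instance by the ₅C-SHADOW route (`s_N23_of_shadow₅C` at def-T's `Node00.exists_isRecordOfRecord₅C_of_isRecordOfRecord₉C`: the shadow has the
same `av`). [cite: Balaban1989LargeFieldII, Thm 1 p.355 (bookkeeping: the routes agree)] -/
theorem s_N23_record₉C_shadow₅C : S_N23 (N := N) fun F D w => IsRecordOfRecord₉C F N D w :=
  s_N23_of_shadow₅C _ fun _ _ _ h => by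
    obtain ⟨D₅, h₅, -, -, -, hav⟩ := exists_isRecordOfRecord₅C_of_isRecordOfRecord₉C h
    exact ⟨D₅, h₅, hav⟩

/-! ## §2 Binder B1's FREE side facts at every ₉C record and at THE datum of record `datumOfRecord₉ θ h` -/

section SideFacts

variable {F : T4Family} {D : Datum F N} {w : WorldP}

/-- The printed one-level leg (0.4) at a ₉C record. [cite: Balaban1987RG1, (0.4) p.253] -/
theorem isPrintedAveraged₁_of_isRecordOfRecord₉C (h : IsRecordOfRecord₉C F N D w) : D.IsPrintedAveraged₁ :=
  N23_leg_oneLevel (isDatumOfRecord₀_of_isRecordOfRecord₉C h)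

/-- Measurable averaging maps at a ₉C record. [cite: Balaban1987RG1, (0.4) p.253 (kernel property of the tree's averaging, by name)] -/
theorem avgMeasurable_of_isRecordOfRecord₉C (h : IsRecordOfRecord₉C F N D w) : D.AvgMeasurable :=
  avgMeasurable_of_isDatumOfRecord₀ (isDatumOfRecord₀_of_isRecordOfRecord₉C h)

/-- The three intertwining identities at a ₉C record. [cite: Balaban1987RG1, (0.4) p.253 («symmetric with respect to the Euclidean transformations of the lattice», p.252)] -/
theorem intertwining_of_isRecordOfRecord₉C (h : IsRecordOfRecord₉C F N D w) :
    D.AvgPermEquivariant ∧ D.AvgTranslEquivariant ∧ D.AvgReflEquivariant :=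
  intertwining_of_isDatumOfRecord₀ (isDatumOfRecord₀_of_isRecordOfRecord₉C h)

/-- **Reflection positivity of the `ε → 0` limit points OUTRIGHT at every ₉C record**, both hypothesis forms. [cite: JaffeWittenClay2006, §6.5 p.11] -/
theorem limit_reflectionPositive_of_isRecordOfRecord₉C (h : IsRecordOfRecord₉C F N D w) :
    D.limit_reflectionPositive' ∧ D.limit_reflectionPositive :=
  limit_reflectionPositive_of_isDatumOfRecord₀ (isDatumOfRecord₀_of_isRecordOfRecord₉C h)

/-- **Torus covariance of the `ε → 0` limit points OUTRIGHT at every ₉C record**, both hypothesis forms. [cite: Balaban1987RG1, (0.4) p.253 (Euclidean symmetry of the centred averaging, p.252)] -/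
theorem limit_torusCovariant_of_isRecordOfRecord₉C (h : IsRecordOfRecord₉C F N D w) :
    D.limit_torusCovariant' ∧ D.limit_torusCovariant :=
  limit_torusCovariant_of_isDatumOfRecord₀ (isDatumOfRecord₀_of_isRecordOfRecord₉C h)

/-- **THE FREE SIDE FACTS (ROSTER row n23 -b) at every ₉C record**: RP and torus covariance of the continuum limit points of the datum's scheme for EVERY
bare-coupling sequence. [cite: Balaban1987RG1, (0.4) p.253; JaffeWittenClay2006, §6.5 p.11] -/
theorem rp_and_covariant_of_isRecordOfRecord₉C (h : IsRecordOfRecord₉C F N D w) (g₀ : ℕ → ℝ) :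
    LimitPointsRP (D.scheme g₀) ∧ LimitPointsCovariant F (D.scheme g₀) :=
  rp_and_covariant_of_s_N23 s_N23_record₉C h g₀

/-- **B5 in ⇒ the four apex targets out** at every ₉C record (scoping-note hypothesis form `BetaPertHyp D.βfun`). [cite: King1986, Thm 3.4 p.656 (existence-leaf template)] -/
theorem targets_of_hybridNE7Under_of_isRecordOfRecord₉C (h : IsRecordOfRecord₉C F N D w)
    (hNE : T4ApexHybrid.HybridNE7Under D (BetaPertHyp D.βfun)) :
    D.ym4_torus_continuum_limit_exists ∧ D.ym4_torus_continuum_limit_unique ∧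
      D.limit_reflectionPositive ∧ D.limit_torusCovariant :=
  targets_of_hybridNE7Under_of_isDatumOfRecord₀ (isDatumOfRecord₀_of_isRecordOfRecord₉C h) hNE

/-- The same in the PRINT-FAITHFUL hypothesis form (β-side = endpoint existence). [cite: Balaban1987RG1, Thm 2 p.259] -/
theorem targets'_of_hybridNE7Under'_of_isRecordOfRecord₉C (h : IsRecordOfRecord₉C F N D w)
    (hNE : T4ApexHybrid.HybridNE7Under D (EndpointExistence D.C.toB12)) :
    D.ym4_torus_continuum_limit_exists' ∧ D.ym4_torus_continuum_limit_unique' ∧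
      D.limit_reflectionPositive' ∧ D.limit_torusCovariant' :=
  targets'_of_hybridNE7Under'_of_isDatumOfRecord₀ (isDatumOfRecord₀_of_isRecordOfRecord₉C h) hNE

/-- At a ₉C record `ContinuumYM4Torus D` IS «the continuum limit exists under the prefix» (uniqueness, RP, covariance are free). [cite: King1986, Thm 3.4 p.656 and p.657] -/
theorem continuumYM4Torus_iff_hasContinuumLimit_of_isRecordOfRecord₉C (h : IsRecordOfRecord₉C F N D w) :
    ContinuumYM4Torus D ↔ ForSmallCouplings D fun g₀ => HasContinuumLimit (D.scheme g₀) :=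
  continuumYM4Torus_iff_hasContinuumLimit_of_isDatumOfRecord₀ (isDatumOfRecord₀_of_isRecordOfRecord₉C h)

end SideFacts

section AtTheDatum

variable {F : T4Family} (θ : Stage9Params F N) (h : θ.Provisos)

/-- Measurable averaging maps AT THE DATUM OF RECORD `datumOfRecord₉ θ h` (every Stage-9 parameter with its provisos; admissibility not read).
[cite: Balaban1987RG1, (0.4) p.253 (kernel property of the tree's averaging, by name)] -/
theorem avgMeasurable_datumOfRecord₉ : (datumOfRecord₉ F N θ h).AvgMeasurable :=
  avgMeasurable_of_isDatumOfRecord₀ (isDatumOfRecord₀_datumOfRecord₉ F N θ h)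

/-- The three intertwining identities at the datum of record. [cite: Balaban1987RG1, (0.4) p.253] -/
theorem intertwining_datumOfRecord₉ :
    (datumOfRecord₉ F N θ h).AvgPermEquivariant ∧ (datumOfRecord₉ F N θ h).AvgTranslEquivariant ∧ (datumOfRecord₉ F N θ h).AvgReflEquivariant :=
  intertwining_of_isDatumOfRecord₀ (isDatumOfRecord₀_datumOfRecord₉ F N θ h)

/-- Reflection positivity of the limit points OUTRIGHT at the datum of record. [cite: JaffeWittenClay2006, §6.5 p.11] -/
theorem limit_reflectionPositive_datumOfRecord₉ :
    (datumOfRecord₉ F N θ h).limit_reflectionPositive' ∧ (datumOfRecord₉ F N θ h).limit_reflectionPositive :=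
  limit_reflectionPositive_of_isDatumOfRecord₀ (isDatumOfRecord₀_datumOfRecord₉ F N θ h)

/-- Torus covariance of the limit points OUTRIGHT at the datum of record. [cite: Balaban1987RG1, (0.4) p.253] -/
theorem limit_torusCovariant_datumOfRecord₉ :
    (datumOfRecord₉ F N θ h).limit_torusCovariant' ∧ (datumOfRecord₉ F N θ h).limit_torusCovariant :=
  limit_torusCovariant_of_isDatumOfRecord₀ (isDatumOfRecord₀_datumOfRecord₉ F N θ h)

/-- **THE FREE SIDE FACTS AT THE DATUM OF RECORD** (ROSTER row n23 -b, at the Stage-9 object): RP and torus covariance of the continuum limit points for every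
bare-coupling sequence. [cite: Balaban1987RG1, (0.4) p.253; JaffeWittenClay2006, §6.5 p.11] -/
theorem rp_and_covariant_datumOfRecord₉ (g₀ : ℕ → ℝ) :
    LimitPointsRP ((datumOfRecord₉ F N θ h).scheme g₀) ∧ LimitPointsCovariant F ((datumOfRecord₉ F N θ h).scheme g₀) :=
  rp_and_covariant_of_isDatumOfRecord₀ (isDatumOfRecord₀_datumOfRecord₉ F N θ h) g₀

/-- B5 in ⇒ the four apex targets out, at the datum of record (scoping-note form). [cite: King1986, Thm 3.4 p.656 (existence-leaf template)] -/
theorem targets_of_hybridNE7Under_datumOfRecord₉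
    (hNE : T4ApexHybrid.HybridNE7Under (datumOfRecord₉ F N θ h) (BetaPertHyp (datumOfRecord₉ F N θ h).βfun)) :
    (datumOfRecord₉ F N θ h).ym4_torus_continuum_limit_exists ∧ (datumOfRecord₉ F N θ h).ym4_torus_continuum_limit_unique ∧
      (datumOfRecord₉ F N θ h).limit_reflectionPositive ∧ (datumOfRecord₉ F N θ h).limit_torusCovariant :=
  targets_of_hybridNE7Under_of_isDatumOfRecord₀ (isDatumOfRecord₀_datumOfRecord₉ F N θ h) hNE

/-- The same in the print-faithful hypothesis form, at the datum of record. [cite: Balaban1987RG1, Thm 2 p.259] -/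
theorem targets'_of_hybridNE7Under'_datumOfRecord₉
    (hNE : T4ApexHybrid.HybridNE7Under (datumOfRecord₉ F N θ h) (EndpointExistence (datumOfRecord₉ F N θ h).C.toB12)) :
    (datumOfRecord₉ F N θ h).ym4_torus_continuum_limit_exists' ∧ (datumOfRecord₉ F N θ h).ym4_torus_continuum_limit_unique' ∧
      (datumOfRecord₉ F N θ h).limit_reflectionPositive' ∧ (datumOfRecord₉ F N θ h).limit_torusCovariant' :=
  targets'_of_hybridNE7Under'_of_isDatumOfRecord₀ (isDatumOfRecord₀_datumOfRecord₉ F N θ h) hNE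

/-- At the datum of record `ContinuumYM4Torus` IS existence of the continuum limit under the prefix. [cite: King1986, Thm 3.4 p.656 and p.657] -/
theorem continuumYM4Torus_iff_hasContinuumLimit_datumOfRecord₉ :
    ContinuumYM4Torus (datumOfRecord₉ F N θ h) ↔
      ForSmallCouplings (datumOfRecord₉ F N θ h) fun g₀ => HasContinuumLimit ((datumOfRecord₉ F N θ h).scheme g₀) :=
  continuumYM4Torus_iff_hasContinuumLimit_of_isDatumOfRecord₀ (isDatumOfRecord₀_datumOfRecord₉ F N θ h)

end AtTheDatum

/-! ## §3 The Track-A apex AT THE STAGE-9 RECORD: B1 eliminated; B1 and B2 eliminated through the END headline -/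

section Apex

variable {F : T4Family} {D : Datum F N} {w : WorldP}

/-- **THE APEX AT EVERY ₉C RECORD, B1 ELIMINATED**: (B2) `B16.EndStatementBPrinted D.C` (N24), (B3 = END) endpoint existence (N25 = NODE O) and (B5) the spine
slot under it (N27) give `ContinuumYM4Torus D`; B1 is def-T's `Node00.isPrintedAveraged_of_isRecordOfRecord₉C`.  Hypothesis shapes in; none of B2, B3, B5 is a
theorem. [cite: Balaban1987RG1, Thm 2 p.259] -/
theorem continuumYM4Torus_of_isRecordOfRecord₉C (h : IsRecordOfRecord₉C F N D w) (hB : B16.EndStatementBPrinted D.C)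
    (hEnd : EndpointExistence D.C.toB12) (hNE : T4ApexHybrid.HybridNE7Under D (EndpointExistence D.C.toB12)) : ContinuumYM4Torus D :=
  continuumYM4Torus_of_isDatumOfRecord₀ (isDatumOfRecord₀_of_isRecordOfRecord₉C h) hB hEnd hNE

/-- The apex at a ₉C record with the β-input PACKAGED as `BetaPertHyp D.βfun` (scoping-note form; at ₉C `D.βfun = betaOfRecord₉ θ`, RIDER №6: a version value).
[cite: JaffeWittenClay2006, §6.5 p.11] -/
theorem continuumYM4Torus_of_isRecordOfRecord₉C_betaPertHyp (h : IsRecordOfRecord₉C F N D w) (hB : B16.EndStatementBPrinted D.C)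
    (hβ : BetaPertHyp D.βfun) (hNE : T4ApexHybrid.HybridNE7Under D (BetaPertHyp D.βfun)) : ContinuumYM4Torus D :=
  continuumYM4Torus_of_isDatumOfRecord₀_betaPertHyp (isDatumOfRecord₀_of_isRecordOfRecord₉C h) hB hβ hNE

/-- **THE WHOLE TRACK-A CHAIN AT THE STAGE-9 RECORD — B1 AND B2 BOTH ELIMINATED**: a ₉C record `(D, w)` with `w.γ ≤ γ₀`, the THIRTEEN PAPER NODES at every run
(`DagBinding.Nodes (leavesP w P)`; N01∕N02∕N04 theorems there — def-T's transferred `Node00.b4∕b5∕b7_main_of_isRecordOfRecord₉C`), the β-WINDOW on `]0, γ₀]`,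
ENDPOINT EXISTENCE (N25) and the hybrid-NE7 SPINE under it (N27) give `ContinuumYM4Torus D`.  (B2) is def-T's `Node00.endStatementBPrinted_of_isRecordOfRecord₉C_of_nodes`
(the Stage-5 END at the SHADOW, then `D₅.C = D.C` — NO `rgFlow` binder); (B1) as above.  Every remaining binder is a declared hypothesis shape; nothing is asserted.
[cite: Balaban1989LargeFieldII, Thm 1 p.355 + p.391; Balaban1987RG1, Thm 2 p.259 and (1.22) p.264 (bookkeeping over the pinned forms)] -/
theorem continuumYM4Torus_of_isRecordOfRecord₉C_of_nodes (h : IsRecordOfRecord₉C F N D w) {γ₀ : ℝ} (hγ₀ : w.γ ≤ γ₀)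
    (hnodes : ∀ P : B12.RunParams, Nodes (leavesP w P)) (hβ : BetaBoundsInInterval w.C.toB12 γ₀ w.b w.βup)
    (hEnd : EndpointExistence D.C.toB12) (hNE : T4ApexHybrid.HybridNE7Under D (EndpointExistence D.C.toB12)) : ContinuumYM4Torus D :=
  continuumYM4Torus_of_isRecordOfRecord₉C h (endStatementBPrinted_of_isRecordOfRecord₉C_of_nodes h hγ₀ hnodes hβ) hEnd hNE

/-- The same chain with the non-vacuity conjunct `ContinuumYM4TorusE D` (tuned bare-coupling sequences EXIST under endpoint existence). [cite: Balaban1987RG1, Thm 2 p.259] -/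
theorem continuumYM4Torus_of_isRecordOfRecord₉C_of_nodes_nonvacuous (h : IsRecordOfRecord₉C F N D w) {γ₀ : ℝ} (hγ₀ : w.γ ≤ γ₀)
    (hnodes : ∀ P : B12.RunParams, Nodes (leavesP w P)) (hβ : BetaBoundsInInterval w.C.toB12 γ₀ w.b w.βup)
    (hEnd : EndpointExistence D.C.toB12) (hNE : T4ApexHybrid.HybridNE7Under D (EndpointExistence D.C.toB12)) :
    ContinuumYM4Torus D ∧ ContinuumYM4TorusE D :=
  continuumYM4Torus_of_isDatumOfRecord₀_nonvacuous (isDatumOfRecord₀_of_isRecordOfRecord₉C h)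
    (endStatementBPrinted_of_isRecordOfRecord₉C_of_nodes h hγ₀ hnodes hβ) hEnd hNE

/-- The law-level form of the chain at a ₉C record: ONE probability law on the loop cube of the torus is the full-sequence weak limit, OS positive on every strict
cone and invariant under the unit-torus isometries (measurability witness = §2's). [cite: Balaban1987RG1, Thm 2 p.259] -/
theorem continuumYM4TorusLaw_of_isRecordOfRecord₉C_of_nodes (h : IsRecordOfRecord₉C F N D w) {γ₀ : ℝ} (hγ₀ : w.γ ≤ γ₀)
    (hnodes : ∀ P : B12.RunParams, Nodes (leavesP w P)) (hβ : BetaBoundsInInterval w.C.toB12 γ₀ w.b w.βup)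
    (hEnd : EndpointExistence D.C.toB12) (hNE : T4ApexHybrid.HybridNE7Under D (EndpointExistence D.C.toB12)) :
    ContinuumYM4TorusLaw D (avgMeasurable_of_isRecordOfRecord₉C h) :=
  continuumYM4TorusLaw_of_isDatumOfRecord₀ (isDatumOfRecord₀_of_isRecordOfRecord₉C h)
    (endStatementBPrinted_of_isRecordOfRecord₉C_of_nodes h hγ₀ hnodes hβ) hEnd hNE

end Apex

/-! ## §4 Cluster K1 «KnitIR» AT THE STAGE-9 RECORD, BY NAME: K1 ⟺ inhabitation ∧ «β₉ never overshoots» -/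

/-- N01 at ₉C (def-T's transferred instance `Node00.b4_main_of_isRecordOfRecord₉C`; dag-n04-a's closers of record untouched). [cite: Balaban1983RegularityDecay, Theorem p.573 (kernel version, transferred)] -/
theorem s_N01_record₉C : S_N01 (N := N) fun F D w => IsRecordOfRecord₉C F N D w :=
  fun _ _ _ h P => b4_main_of_isRecordOfRecord₉C h P

/-- N02 at ₉C (def-T's transferred instance `Node00.b5_main_of_isRecordOfRecord₉C`). [cite: Balaban1984PropagatorsI, Props. 1.1–1.2 pp.33–36 (kernel versions, transferred)] -/
theorem s_N02_record₉C : S_N02 (N := N) fun F D w => IsRecordOfRecord₉C F N D w :=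
  fun _ _ _ h P => b5_main_of_isRecordOfRecord₉C h P

/-- **K1 AT THE STAGE-9 RECORD IS W00's STUB**: with N01 ∕ N02 ∕ N23 theorems there, `KnitIR (₉C) ↔ S_W00 (₉C)` (`N01AtRecord.knitIR_iff_stubs`).
[cite: Balaban1987RG1, (0.20) p.256 (bookkeeping)] -/
theorem knitIR₉C_iff_S_W00 :
    KnitIR (fun (F : T4Family) (D : Datum F N) (w : WorldP) => IsRecordOfRecord₉C F N D w) ↔
      S_W00 (fun (F : T4Family) (D : Datum F N) (w : WorldP) => IsRecordOfRecord₉C F N D w) := by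
  rw [knitIR_iff_stubs]
  exact ⟨fun h => h.1, fun hW => ⟨hW, s_N01_record₉C, s_N02_record₉C, s_N23_record₉C⟩⟩

/-- **W00's stub at ₉C UNFOLDED**: its binding clauses `w.C = D.C` ∕ `0 < w.γ` are record theorems (`Node00.construction_eq_∕gamma_pos_of_isRecordOfRecord₉C`), so
`S_W00 (₉C)` IS inhabitation ∧ the UNGUARDED (0.20) leaf `rgFlow` at every run of every ₉C world. [cite: Balaban1987RG1, (0.20) p.256 (bookkeeping)] -/
theorem s_W00_record₉C_iff :
    S_W00 (fun (F : T4Family) (D : Datum F N) (w : WorldP) => IsRecordOfRecord₉C F N D w) ↔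
      (∀ F : T4Family, ∃ (D : Datum F N) (w : WorldP), IsRecordOfRecord₉C F N D w) ∧
        AtRecord (fun (F : T4Family) (D : Datum F N) (w : WorldP) => IsRecordOfRecord₉C F N D w) fun ℓ => ℓ.rgFlow := by
  refine and_congr_right fun _ => forall₃_congr fun F D w => imp_congr_right fun hw => ?_
  exact ⟨fun hf => hf.2.2, fun hrg => ⟨construction_eq_of_isRecordOfRecord₉C hw, gamma_pos_of_isRecordOfRecord₉C hw, hrg⟩⟩

/-- **K1 AT THE STAGE-9 RECORD, BY NAME**: `construction` ∕ `gamma_pos` ∕ the Stage-0 datum clause (N23) ∕ N02 ∕ N01 are theorems at ₉C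
(`Node00.construction_eq_∕gamma_pos_∕isDatumOfRecord₀_∕b5_main_∕b4_main_of_isRecordOfRecord₉C`), so `KnitIR (₉C)` IS inhabitation ∧ the UNGUARDED (0.20) leaf at
every run. [cite: Balaban1987RG1, (0.20) p.256; Balaban1983RegularityDecay, Theorem p.573 (bookkeeping)] -/
theorem knitIR₉C_iff :
    KnitIR (fun (F : T4Family) (D : Datum F N) (w : WorldP) => IsRecordOfRecord₉C F N D w) ↔
      (∀ F : T4Family, ∃ (D : Datum F N) (w : WorldP), IsRecordOfRecord₉C F N D w) ∧
        AtRecord (fun (F : T4Family) (D : Datum F N) (w : WorldP) => IsRecordOfRecord₉C F N D w) fun ℓ => ℓ.rgFlow := by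
  rw [knitIR₉C_iff_S_W00, s_W00_record₉C_iff]

/-- **THE UNGUARDED (0.20) LEAF AT A STAGE-9 WORLD, UNFOLDED** (the tower-form assembler's `RGMachineCore.satisfiesRG_construction_iff` at the core of record: the
₉ construction's flow is `genFlow (betaOfRecord₉ θ) g₀`): along run `P`, (0.20) holds for ALL `k < P.K` — no interval guard — IFF the β OF RECORD never
overshoots along the generated couplings, `β₉ k (g_0,…,g_k) ≤ 1∕g_k²` for `k < P.K`. [cite: Balaban1987RG1, (0.18)–(0.20) pp.255–256] -/
theorem rgFlow_iff_noOvershoot_record₉ {F : T4Family} (θ : Stage9Params F N) (h : θ.Provisos) (w : WorldP)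
    (hC : w.C = (datumOfRecord₉ F N θ h).C) (P : B12.RunParams) :
    (leavesP w P).rgFlow ↔
      ∀ k, k < P.K → betaOfRecord₉ F N θ k (prefixOf (genSeq (betaOfRecord₉ F N θ) P.g0) k) ≤ 1 / (genSeq (betaOfRecord₉ F N θ) P.g0 k) ^ 2 := by
  show (w.C P).flow.SatisfiesRG P.K ↔ _
  rw [hC, datumOfRecord₉_C]
  exact (coreOfRecord₉ F N θ).satisfiesRG_construction_iff (densOfRecord₉ F N θ) P P.K

/-- **THE UNGUARDED (0.20) CONJUNCT OF W00's STUB AT ₉C IS «NO OVERSHOOT OF β₉»**: `AtRecord (₉C) rgFlow` holds IFF at EVERY admissible Stage-9 parameter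
satisfying its provisos, on every family, the β of record never overshoots along any generated history (forward: every such `θ` presents a ₉C world,
`Node00.exists_world_isRecordOfRecord₉C`; backward: the pointed unfolding).  The GUARDED leaf along in-window runs is def-T's theorem
`Node00.rgFlow_of_smallCouplings_of_isRecordOfRecord₉C` — not this. [cite: Balaban1987RG1, (0.18)–(0.20) pp.255–256 (bookkeeping)] -/
theorem atRecord₉C_rgFlow_iff_noOvershoot :
    AtRecord (fun (F : T4Family) (D : Datum F N) (w : WorldP) => IsRecordOfRecord₉C F N D w) (fun ℓ => ℓ.rgFlow) ↔
      ∀ (F : T4Family) (θ : Stage9Params F N) (h : θ.Provisos), θ.Admissible →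
        ∀ (p : B12.RunParams) (k : ℕ), k < p.K →
          betaOfRecord₉ F N θ k (prefixOf (genSeq (betaOfRecord₉ F N θ) p.g0) k) ≤ 1 / (genSeq (betaOfRecord₉ F N θ) p.g0 k) ^ 2 := by
  constructor
  · intro hA F θ h hθ p
    obtain ⟨w, hw, -⟩ := exists_world_isRecordOfRecord₉C F N θ h hθ ⟨hθ.gamma_pos, le_rfl⟩
    exact (rgFlow_iff_noOvershoot_record₉ θ h w (construction_eq_of_isRecordOfRecord₉C hw) p).mp (hA F _ w hw p)
  · intro hno F D w hw P
    obtain ⟨θ, h, hθ, rfl, hC, -⟩ := hw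
    exact (rgFlow_iff_noOvershoot_record₉ θ h w hC P).mpr (hno F θ h hθ P)

/-- **CLUSTER K1 AT THE RECORD OF RECORD, THE CENSUS**: `KnitIR (₉C)` ⟺ «some admissible Stage-9 parameter satisfies the displayed provisos on every family»
(plan K0 `Record9Inhabited`'s shape — NOT claimed here) ∧ «the β OF RECORD never overshoots along any generated history at any admissible parameter with
provisos» (the unguarded (0.20) face; off the box `]0,θ.γ]^{k+1}` `betaOfRecord₉` is the one-loop number `β⁰`, `Node00.betaOfMerged_of_notMem` (`Record8.betaOfRecord₈`; at ₉ `betaOfRecord₉ θ = betaOfRecord₈ θ.toStage8Params`), so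
large bare couplings are NOT excluded by typing — `FlowStepBoxExtension` §2).  N01 ∕ N02 ∕ N23 and the two binding clauses are theorems at ₉C and drop out.
[cite: Balaban1987RG1, (0.18)–(0.20) pp.255–256 and (1.22) p.264 (bookkeeping)] -/
theorem knitIR₉C_iff_inhabited_and_noOvershoot :
    KnitIR (fun (F : T4Family) (D : Datum F N) (w : WorldP) => IsRecordOfRecord₉C F N D w) ↔
      (∀ F : T4Family, ∃ (D : Datum F N) (w : WorldP), IsRecordOfRecord₉C F N D w) ∧
        ∀ (F : T4Family) (θ : Stage9Params F N) (h : θ.Provisos), θ.Admissible →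
          ∀ (p : B12.RunParams) (k : ℕ), k < p.K →
            betaOfRecord₉ F N θ k (prefixOf (genSeq (betaOfRecord₉ F N θ) p.g0) k) ≤ 1 / (genSeq (betaOfRecord₉ F N θ) p.g0 k) ^ 2 := by
  rw [knitIR₉C_iff, atRecord₉C_rgFlow_iff_noOvershoot]

/-- The inhabitation conjunct REDUCED (def-T's `Node00.exists_world_isRecordOfRecord₉C`): the ₉C class is inhabited on a family IFF some admissible Stage-9
parameter satisfies its displayed provisos there — plan K0's literal reading; nothing about it is claimed. [cite: Balaban1989LargeFieldII, Thm 1 p.355 (bookkeeping)] -/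
theorem inhabited₉C_iff (F : T4Family) :
    (∃ (D : Datum F N) (w : WorldP), IsRecordOfRecord₉C F N D w) ↔ ∃ θ : Stage9Params F N, θ.Provisos ∧ θ.Admissible := by
  constructor
  · rintro ⟨D, w, θ, h, hθ, -⟩
    exact ⟨θ, h, hθ⟩
  · rintro ⟨θ, h, hθ⟩
    obtain ⟨w, hw, -⟩ := exists_world_isRecordOfRecord₉C F N θ h hθ ⟨hθ.gamma_pos, le_rfl⟩
    exact ⟨_, w, hw⟩

end Summit.QuantumFields.YangMills.BalabanUVNodes.N23AtRecord9

end
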